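import Literature.Barriers.Parity.SiegelZeroDichotomy
import Mathlib.Analysis.Calculus.BumpFunction.InnerProduct
import Mathlib.NumberTheory.SmoothNumbers
import Mathlib.NumberTheory.DirichletCharacter.Bounds
import HarnessLib

/-!
# The Liouville side of the Siegel-zero dichotomy: the proof architecture of
# `TaoTeravainen2021_chowla` (Tao–Teräväinen 2022, Corollary 1.8 (ii) = Theorem 1.6 with `k = 0`)

Topic `Literature/Barriers/Parity`, companion of the catalogue entry `SiegelZeroDichotomy.lean`,
whose named fact `Literature.Barriers.Parity.TaoTeravainen2021_chowla` is Tao–Teräväinen's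
Corollary 1.8 (ii): for distinct fixed shifts `h'₁, …, h'_ℓ ≥ 1` and fixed `0 < ε₀ < 1`,
`𝔼_{n ≤ x} λ(n+h'₁)⋯λ(n+h'_ℓ) ≪ log^{-1/10} η` uniformly over Siegel zeros (`IsSiegelZero χ η`,
Definition 1.4) and `q_χ^{1/2+ε₀} ≤ x ≤ q_χ^{η^{1/2}}`. The source obtains it as "a direct
corollary to Theorem 1.6" (the case `k = 0`, no von Mangoldt factor, where the singular series
term is `0`), and proves Theorem 1.6 by the chain of approximations (1.5): "the proof of Theorem 1.6
proceeds by justifying all of the following approximations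
`𝔼 Λ⋯Λ λ⋯λ ≈(i) 𝔼 Λ⋯Λ λ_Siegel⋯λ_Siegel ≈(ii) 𝔼 Λ_Siegel⋯ λ_Siegel⋯ ≈(iii) 𝔼 Λ_Siegel⋯ λ♯_Siegel⋯
≈(iv) 𝔼 Λ♯_Siegel⋯ λ♯_Siegel⋯ ≈(v) 𝔖`", "The steps (i)-(v) are executed in Sections 4–8
respectively. Interestingly, the hypothesis `k ≤ 2` is only used in step (iv)"; §8: "Clearly
Theorem 1.6 follows immediately from concatenating together Propositions 4.2, 5.2, 6.3, 7.2, 8.1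
using (1.5)." For `k = 0` steps (ii) and (iv) are void, and the chain is
`𝔼 λ⋯λ ≈ 𝔼 λ_Siegel⋯λ_Siegel` (Proposition 4.2) `≈ 𝔼 λ♯_Siegel⋯λ♯_Siegel` (Proposition 6.3)
`≈ 0` (Proposition 8.1, "the easy case `ℓ > 0`, in which `𝔖` vanishes").
[cite: TaoTeravainen2021, §1.2 (1.5), §8 (first paragraph), Corollary 1.8]

This file records that top layer of the proof DAG, sorry-free:

* the objects of the source, as real definitions: the Siegel model
  `λ_Siegel := λ_(≤R) ∗ χ_(>R)` ((4.1): "the completely multiplicative function that agrees with `λ`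
  for primes `p ≤ R` and agrees with `χ` for primes `p > R`") = `liouvilleSiegel χ R`; its Type I
  approximant `λ♯_Siegel := (λ ∗ μχ)_(≤R) ψ_{≤D} ∗ χ` ((6.2)) = `liouvilleSiegelSharp χ ψ R D`, with
  `ψ_{≤D}(n) := ψ(log_D n)` ((2.12)) for the fixed smooth cutoff `ψ` of §2.5 ("a smooth function
  `ψ : ℝ → ℝ` supported on `[-1,1]` that equals to `1` on `[-1/2,1/2]`") = `IsSmoothCutoff ψ`; the
  scales `R := x^{1/log^{1/(5 max(1,k))} η}` ((2.3)) = `scaleR η x` and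
  `D := x^{ε₀/(10(k+ℓ))}` ((2.4)) = `scaleD ℓ ε₀ x` at `k = 0`;
* the three steps as NAMED FACTS, in their `k = 0` specialisations (docstrings):
  `TaoTeravainen2021_prop42_k0`, `TaoTeravainen2021_prop63_k0`, `TaoTeravainen2021_prop81_k0`;
* the assembly, PROVED: `TaoTeravainen2021_chowla_of_steps : prop42_k0 → prop63_k0 → prop81_k0 →
  TaoTeravainen2021_chowla` (the concatenation of §8 plus the bookkeeping of §2.1: `ε₀` may be
  shrunk, and for `η = O(1)` the claim is trivial since `|𝔼 λ⋯λ| ≤ 1`).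

The discharge `TaoTeravainen2021_chowla_holds` is thereby reduced to the three step facts; their
own inputs in the source are Corollary 3.6 (sparsity of exceptional primes, from Proposition 3.5:
Siegel's theorem — proved in this tree, `Literature.NumberTheory.LFunctions.Siegel.siegel_theorem_primitive` —
and Montgomery–Vaughan's asymptotics for `∑ (1∗χ)(n)/n` and `L'/L(1, χ)`), the sieve bound
Lemma 3.2 and Mertens' theorems (step (i)); Lemma 6.1, Landreau's inequality Lemma 3.1 and
Lemma 3.4 (step (iii)); and Lemma 3.7 = the Weil bound for complete character sums with polynomial
argument plus completion of sums (step (v)). [cite: TaoTeravainen2021, §3–§4, §6, §8]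

## What the source prints (arXiv:2109.06291, TeX text read in full; numbering of the journal version)

* §2.1: "`X ≪ Y` … `|X| ≤ CY` where `C` is a constant which is allowed to depend on the "fixed"
  quantities `k, ℓ, h₁, …, h_k, h'₁, …, h'_ℓ, ε₀`; we permit the constants to be ineffective";
  "By shrinking `ε₀` if necessary, we may assume that `ε₀` is sufficiently small depending on
  `k, ℓ`. We will also assume that `η` is sufficiently large depending on the fixed quantities";
  "we do not impose the restriction (1.7) [`q_χ^{10k+1/2+ε₀} ≤ x ≤ q_χ^{η^{1/2}}`] on `x > 1`
  before Section 4". (2.6): "`X ≈ Y`" abbreviates "`X = Y + O(log^{-1/(10 max(1,k))} η)`".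
* §2.3: `n_(p)` the largest power of `p` dividing `n`; `ℕ_(≤z)` the `z`-smooth numbers (all prime
  factors `≤ z`); `f_(≤z) := f 1_{ℕ_(≤z)}`, `f_(>z) := f 1_{ℕ_(>z)}`; `f ∗ g` Dirichlet convolution.
* Proposition 4.2 (Replacing `λ` with a Siegel model): "`𝔼_{n ≤ x} Λ(n+h₁)⋯Λ(n+h_k) λ(n+h'₁)⋯
  λ(n+h'_ℓ) ≈ 𝔼_{n ≤ x} Λ(n+h₁)⋯Λ(n+h_k) λ_Siegel(n+h'₁)⋯λ_Siegel(n+h'_ℓ)`."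
* Proposition 6.3 (Replacing `λ_Siegel` with a Type I approximant): the same with
  `Λ_Siegel, λ_Siegel` on the left and `Λ_Siegel, λ♯_Siegel` on the right.
* Proposition 8.1 (Evaluating the Type I correlation): "`𝔼_{n ≤ x} Λ♯_Siegel(n+h₁)⋯Λ♯_Siegel(n+h_k)
  λ♯_Siegel(n+h'₁)⋯λ♯_Siegel(n+h'_ℓ) ≈ 𝔖` where `𝔖` is the quantity in Conjecture 1.3"; "We first
  dispose of the easy case `ℓ > 0`, in which `𝔖` vanishes."

## Design notes

1. `k = 0` throughout (no `Λ`-factors, `max(1,k) = 1`, `k + ℓ = ℓ = #H`): the facts are the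
   printed propositions restricted to `k = 0`, which only weakens them; `𝔼_{n ≤ x}` is the average
   over `1 ≤ n ≤ x` with `x ∈ ℕ`, shifts a `Finset` of naturals `≥ 1`, as in `TaoTeravainen2021_chowla`.
2. Quantifier shape of "`≈`" under the standing assumptions of §2.1: after the fixed data
   (`H`, and `ψ` where it occurs) comes `∃ ε₁ > 0` ("shrinking `ε₀` … depending on `k, ℓ`"; letting
   it depend on all fixed data is weaker), then `∀ ε₀ ∈ (0, ε₁]`, then `∃ C η₁` (the implied
   constant and "η sufficiently large depending on the fixed quantities"), then all Siegel zeros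
   (`IsSiegelZero`, any conductor) with `η ≥ η₁` and all `x` in the range (1.7) for `k = 0`.
3. The objects live in the sub-namespace `Literature.Barriers.Parity.TaoTeravainen` (they are
   this paper's constructions); the facts and the assembly are in `Literature.Barriers.Parity`.
   `χ` enters the real-valued objects through `realChar χ n = Re χ(n)` (`χ` is quadratic, so
   `χ(n) ∈ {0, ±1}`); `ℕ_(≤R)` is Mathlib's `Nat.smoothNumbers (⌊R⌋₊ + 1)` (prime factors `≤ ⌊R⌋`,
   i.e. `≤ R`); `ψ` is universally quantified over `IsSmoothCutoff` (the source fixes one such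
   `ψ`; every choice is covered), and `exists_isSmoothCutoff` supplies one for the assembly.
4. NOT here: the cases `k = 1, 2` (Propositions 5.2, 7.2, the singular series), and the proofs of
   the three steps (see the DAG above) — they are the remaining work towards
   `TaoTeravainen2021_chowla_holds`.
-/

noncomputable section

open Finset
open scoped ContDiff

namespace Literature.Barriers.Parity

namespace TaoTeravainen

/-! ### The objects of the source (`k = 0`) -/

/-- The real-valued version `n ↦ Re χ(n)` of a Dirichlet character (for the quadratic `χ` of a
Siegel zero, `χ(n) ∈ {0, ±1}` and nothing is lost). [folklore] -/
def realChar {q : ℕ} (χ : DirichletCharacter ℂ q) (n : ℕ) : ℝ :=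
  (χ (n : ZMod q)).re

/-- `|Re χ(n)| ≤ 1`. [folklore] -/
theorem abs_realChar_le_one {q : ℕ} (χ : DirichletCharacter ℂ q) (n : ℕ) : |realChar χ n| ≤ 1 :=
  (Complex.abs_re_le_norm _).trans (χ.norm_le_one _)

/-- **The Siegel model of the Liouville function** `λ_Siegel := λ_(≤R) ∗ χ_(>R)`: "the completely
multiplicative function that agrees with `λ` for primes `p ≤ R` and agrees with `χ` for primes
`p > R`" — the product over the prime factors of `n`, with multiplicity, of `-1` (`p ≤ R`) resp.
`χ(p)` (`p > R`). [cite: TaoTeravainen2021, §4 (4.1)] -/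
def liouvilleSiegel {q : ℕ} (χ : DirichletCharacter ℂ q) (R : ℝ) (n : ℕ) : ℝ :=
  (n.primeFactorsList.map fun p : ℕ => if (p : ℝ) ≤ R then (-1 : ℝ) else realChar χ p).prod

/-- `λ_Siegel` at a prime. [cite: TaoTeravainen2021, §4 (4.1)] -/
theorem liouvilleSiegel_apply_prime {q : ℕ} (χ : DirichletCharacter ℂ q) (R : ℝ) {p : ℕ}
    (hp : p.Prime) : liouvilleSiegel χ R p = if (p : ℝ) ≤ R then -1 else realChar χ p := by
  simp [liouvilleSiegel, Nat.primeFactorsList_prime hp]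

/-- `λ_Siegel` is completely multiplicative. [cite: TaoTeravainen2021, §4 (4.1)] -/
theorem liouvilleSiegel_mul {q : ℕ} (χ : DirichletCharacter ℂ q) (R : ℝ) {m n : ℕ} (hm : m ≠ 0)
    (hn : n ≠ 0) :
    liouvilleSiegel χ R (m * n) = liouvilleSiegel χ R m * liouvilleSiegel χ R n := by
  unfold liouvilleSiegel
  rw [((Nat.perm_primeFactorsList_mul hm hn).map _).prod_eq, List.map_append, List.prod_append]

/-- "(4.2): Clearly `λ`, `λ_Siegel` are both bounded by `1`." [cite: TaoTeravainen2021, §4 (4.2)] -/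
theorem abs_liouvilleSiegel_le_one {q : ℕ} (χ : DirichletCharacter ℂ q) (R : ℝ) (n : ℕ) :
    |liouvilleSiegel χ R n| ≤ 1 := by
  unfold liouvilleSiegel
  induction n.primeFactorsList with
  | nil => simp
  | cons p l ih =>
    rw [List.map_cons, List.prod_cons, abs_mul]
    refine mul_le_one₀ ?_ (abs_nonneg _) ih
    split_ifs
    · simp
    · exact abs_realChar_le_one χ p

/-- The Dirichlet convolution `(λ ∗ μχ)(d) = ∑_{ab = d} λ(a) μ(b) χ(b)` entering `λ♯_Siegel`
(§6, first display: `λ_Siegel = (λ ∗ μχ)_(≤R) ∗ χ`). [cite: TaoTeravainen2021, §6 (6.2)] -/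
def lamMuChi {q : ℕ} (χ : DirichletCharacter ℂ q) (d : ℕ) : ℝ :=
  ∑ p ∈ d.divisorsAntidiagonal,
    (ArithmeticFunction.liouville p.1 : ℝ) * (ArithmeticFunction.moebius p.2 : ℝ) * realChar χ p.2

/-- **The Type I approximant** `λ♯_Siegel := (λ ∗ μχ)_(≤R) ψ_{≤D} ∗ χ` ((6.2)), i.e.
`λ♯_Siegel(n) = ∑_{de = n, d ∈ ℕ_(≤R)} (λ ∗ μχ)(d) ψ(log_D d) χ(e)`, with the smooth cutoff
`ψ_{≤D}(d) := ψ(log_D d)` of (2.12) and `ℕ_(≤R)` the `R`-smooth numbers (all prime factors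
`≤ R`; Mathlib's `Nat.smoothNumbers (⌊R⌋₊ + 1)`). [cite: TaoTeravainen2021, §6 (6.2) and §2.5 (2.12)] -/
def liouvilleSiegelSharp {q : ℕ} (χ : DirichletCharacter ℂ q) (ψ : ℝ → ℝ) (R D : ℝ) (n : ℕ) : ℝ :=
  ∑ p ∈ n.divisorsAntidiagonal,
    (if p.1 ∈ Nat.smoothNumbers (⌊R⌋₊ + 1) then lamMuChi χ p.1 * ψ (Real.log p.1 / Real.log D)
      else 0) * realChar χ p.2

/-- The scale `R := x^{1/log^{1/(5 max(1,k))} η}` of (2.3) at `k = 0`: `R = x^{1/log^{1/5} η}`.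
[cite: TaoTeravainen2021, §2.4 (2.3)] -/
def scaleR (η x : ℝ) : ℝ :=
  x ^ (1 / Real.log η ^ ((1 : ℝ) / 5))

/-- The scale `D := x^{ε₀/(10(k+ℓ))}` of (2.4) at `k = 0`: `D = x^{ε₀/(10ℓ)}`.
[cite: TaoTeravainen2021, §2.4 (2.4)] -/
def scaleD (ℓ : ℕ) (ε₀ x : ℝ) : ℝ :=
  x ^ (ε₀ / (10 * ℓ))

/-- **The fixed smooth cutoff of §2.5**: "a smooth function `ψ : ℝ → ℝ` supported on `[-1,1]` that
equals to `1` on `[-1/2,1/2]`" (for a continuous function, support in `[-1,1]` means vanishing on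
`|u| ≥ 1`). [cite: TaoTeravainen2021, §2.5] -/
structure IsSmoothCutoff (ψ : ℝ → ℝ) : Prop where
  contDiff : ContDiff ℝ ∞ ψ
  eq_one : ∀ u : ℝ, |u| ≤ 1 / 2 → ψ u = 1
  eq_zero : ∀ u : ℝ, 1 ≤ |u| → ψ u = 0

/-- Such cutoffs exist (Mathlib's smooth bump functions). [folklore] -/
theorem exists_isSmoothCutoff : ∃ ψ : ℝ → ℝ, IsSmoothCutoff ψ :=
  let b : ContDiffBump (0 : ℝ) := ⟨1 / 2, 1, by norm_num, by norm_num⟩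
  ⟨b, b.contDiff, fun u hu => b.one_of_mem_closedBall (by
      rw [Metric.mem_closedBall, Real.dist_eq, sub_zero]; exact hu),
    fun u hu => b.zero_of_le_dist (by rw [Real.dist_eq, sub_zero]; exact hu)⟩

/-- `𝔼_{n ≤ x} ∏_{h ∈ H} f(n + h)` for a real sequence `f` (average over `1 ≤ n ≤ x`); at `f = λ`
this is `liouvilleTupleAverage`. [cite: TaoTeravainen2021, §1.1 (the notation `𝔼_{n ∈ A}`)] -/
def tupleAverage (f : ℕ → ℝ) (H : Finset ℕ) (x : ℕ) : ℝ :=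
  (∑ n ∈ Icc 1 x, ∏ h ∈ H, f (n + h)) / x

/-- `liouvilleTupleAverage` is the tuple average of `λ`. [folklore] -/
theorem liouvilleTupleAverage_eq_tupleAverage (H : Finset ℕ) (x : ℕ) :
    liouvilleTupleAverage H x = tupleAverage (fun n => (ArithmeticFunction.liouville n : ℝ)) H x :=
  rfl

/-- A tuple average of a `1`-bounded sequence is `1`-bounded. [folklore] -/
theorem abs_tupleAverage_le_one {f : ℕ → ℝ} (hf : ∀ n, |f n| ≤ 1) (H : Finset ℕ) (x : ℕ) :
    |tupleAverage f H x| ≤ 1 := by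
  unfold tupleAverage
  rcases Nat.eq_zero_or_pos x with rfl | hx
  · simp
  have hx' : (0 : ℝ) < x := by exact_mod_cast hx
  rw [abs_div, abs_of_pos hx', div_le_one hx']
  calc |∑ n ∈ Icc 1 x, ∏ h ∈ H, f (n + h)| ≤ ∑ n ∈ Icc 1 x, |∏ h ∈ H, f (n + h)| :=
        abs_sum_le_sum_abs _ _
    _ ≤ ∑ _n ∈ Icc 1 x, (1 : ℝ) := by
        refine sum_le_sum fun n _ => ?_
        rw [abs_prod]
        exact prod_le_one (fun _ _ => abs_nonneg _) fun h _ => hf (n + h)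
    _ = x := by simp

end TaoTeravainen

open TaoTeravainen

/-- `|𝔼_{n ≤ x} λ(n+h'₁)⋯λ(n+h'_ℓ)| ≤ 1` (the trivial bound that settles the case `η = O(1)`,
§2.1). [folklore] -/
theorem abs_liouvilleTupleAverage_le_one (H : Finset ℕ) (x : ℕ) :
    |liouvilleTupleAverage H x| ≤ 1 :=
  abs_tupleAverage_le_one Literature.NumberTheory.Sieve.abs_liouville_le_one H x

/-! ### The three steps of the chain (1.5) at `k = 0`, as named facts -/

/-- **Tao–Teräväinen 2022, Proposition 4.2 (step (i): replacing `λ` with a Siegel model), case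
`k = 0`.** For fixed distinct shifts `h'₁, …, h'_ℓ ≥ 1` (`ℓ ≥ 1`), after shrinking `ε₀`
(`0 < ε₀ ≤ ε₁(H)`), there are `C`, `η₁` (depending on the fixed quantities, ineffective) such that
for every Siegel zero of quality `η ≥ η₁` and conductor `q` and all `q^{1/2+ε₀} ≤ x ≤ q^{η^{1/2}}`:
`|𝔼_{n ≤ x} ∏ⱼ λ(n+h'ⱼ) - 𝔼_{n ≤ x} ∏ⱼ λ_Siegel(n+h'ⱼ)| ≤ C / log^{1/10} η`, where
`λ_Siegel = λ_(≤R) ∗ χ_(>R)`, `R = x^{1/log^{1/5} η}`. A NAMED FACT (source inputs: Lemma 4.1,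
Lemma 3.2, Mertens, Corollary 3.6). [cite: TaoTeravainen2021, Proposition 4.2 (with §2.1, (2.3), (2.6), (4.1))] -/
def TaoTeravainen2021_prop42_k0 : Prop :=
  ∀ H : Finset ℕ, H.Nonempty → (∀ h ∈ H, 1 ≤ h) →
    ∃ ε₁ : ℝ, 0 < ε₁ ∧ ∀ ε₀ : ℝ, 0 < ε₀ → ε₀ ≤ ε₁ →
      ∃ C η₁ : ℝ, ∀ (q : ℕ) [NeZero q] (χ : DirichletCharacter ℂ q) (η : ℝ), IsSiegelZero χ η →
        η₁ ≤ η → ∀ x : ℕ, (q : ℝ) ^ ((1 : ℝ) / 2 + ε₀) ≤ x → (x : ℝ) ≤ (q : ℝ) ^ Real.sqrt η →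
          |liouvilleTupleAverage H x - tupleAverage (liouvilleSiegel χ (scaleR η x)) H x| ≤
            C / Real.log η ^ ((1 : ℝ) / 10)

/-- **Tao–Teräväinen 2022, Proposition 6.3 (step (iii): replacing `λ_Siegel` with a Type I
approximant), case `k = 0`.** For fixed distinct shifts `h'₁, …, h'_ℓ ≥ 1` and a fixed smooth
cutoff `ψ` (§2.5), after shrinking `ε₀`, there are `C`, `η₁` such that for every Siegel zero of
quality `η ≥ η₁` and conductor `q` and all `q^{1/2+ε₀} ≤ x ≤ q^{η^{1/2}}`:
`|𝔼_{n ≤ x} ∏ⱼ λ_Siegel(n+h'ⱼ) - 𝔼_{n ≤ x} ∏ⱼ λ♯_Siegel(n+h'ⱼ)| ≤ C / log^{1/10} η`, where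
`λ♯_Siegel = (λ ∗ μχ)_(≤R) ψ_{≤D} ∗ χ`, `R = x^{1/log^{1/5} η}`, `D = x^{ε₀/(10ℓ)}`. A NAMED FACT
(source inputs: Lemma 6.1, Landreau's inequality (3.9), Lemma 3.4, Mertens).
[cite: TaoTeravainen2021, Proposition 6.3 (with §2.1, (2.3), (2.4), (2.6), (6.2))] -/
def TaoTeravainen2021_prop63_k0 : Prop :=
  ∀ H : Finset ℕ, H.Nonempty → (∀ h ∈ H, 1 ≤ h) → ∀ ψ : ℝ → ℝ, IsSmoothCutoff ψ →
    ∃ ε₁ : ℝ, 0 < ε₁ ∧ ∀ ε₀ : ℝ, 0 < ε₀ → ε₀ ≤ ε₁ →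
      ∃ C η₁ : ℝ, ∀ (q : ℕ) [NeZero q] (χ : DirichletCharacter ℂ q) (η : ℝ), IsSiegelZero χ η →
        η₁ ≤ η → ∀ x : ℕ, (q : ℝ) ^ ((1 : ℝ) / 2 + ε₀) ≤ x → (x : ℝ) ≤ (q : ℝ) ^ Real.sqrt η →
          |tupleAverage (liouvilleSiegel χ (scaleR η x)) H x -
              tupleAverage (liouvilleSiegelSharp χ ψ (scaleR η x) (scaleD #H ε₀ x)) H x| ≤
            C / Real.log η ^ ((1 : ℝ) / 10)

/-- **Tao–Teräväinen 2022, Proposition 8.1 (step (v): evaluating the Type I correlation), case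
`k = 0`, `ℓ ≥ 1`** ("the easy case `ℓ > 0`, in which `𝔖` vanishes"). For fixed distinct shifts
`h'₁, …, h'_ℓ ≥ 1` and a fixed smooth cutoff `ψ`, after shrinking `ε₀`, there are `C`, `η₁` such
that for every Siegel zero of quality `η ≥ η₁` and conductor `q` and all
`q^{1/2+ε₀} ≤ x ≤ q^{η^{1/2}}`: `|𝔼_{n ≤ x} ∏ⱼ λ♯_Siegel(n+h'ⱼ)| ≤ C / log^{1/10} η`
(`λ♯_Siegel`, `R`, `D` as in `TaoTeravainen2021_prop63_k0`). A NAMED FACT (source inputs: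
Lemma 3.7 = Weil bound and completion of sums, summation by parts, (2.9), (2.11)).
[cite: TaoTeravainen2021, Proposition 8.1 (case ℓ > 0; with §2.1, (2.3), (2.4), (2.6), (6.2))] -/
def TaoTeravainen2021_prop81_k0 : Prop :=
  ∀ H : Finset ℕ, H.Nonempty → (∀ h ∈ H, 1 ≤ h) → ∀ ψ : ℝ → ℝ, IsSmoothCutoff ψ →
    ∃ ε₁ : ℝ, 0 < ε₁ ∧ ∀ ε₀ : ℝ, 0 < ε₀ → ε₀ ≤ ε₁ →
      ∃ C η₁ : ℝ, ∀ (q : ℕ) [NeZero q] (χ : DirichletCharacter ℂ q) (η : ℝ), IsSiegelZero χ η →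
        η₁ ≤ η → ∀ x : ℕ, (q : ℝ) ^ ((1 : ℝ) / 2 + ε₀) ≤ x → (x : ℝ) ≤ (q : ℝ) ^ Real.sqrt η →
          |tupleAverage (liouvilleSiegelSharp χ ψ (scaleR η x) (scaleD #H ε₀ x)) H x| ≤
            C / Real.log η ^ ((1 : ℝ) / 10)

/-! ### The assembly (§8, first paragraph, and §2.1), proved -/

/-- **Corollary 1.8 (ii) from the three steps** ("Theorem 1.6 follows immediately from
concatenating together Propositions 4.2, …, 8.1 using (1.5)", here with `k = 0`): given the
facts `TaoTeravainen2021_prop42_k0`, `_prop63_k0`, `_prop81_k0`, the named fact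
`TaoTeravainen2021_chowla` holds. Bookkeeping as in §2.1: fix a cutoff `ψ`
(`exists_isSmoothCutoff`), shrink `ε₀` to the least of the three thresholds (the range
`q^{1/2+ε₀} ≤ x` only widens), add the three errors for `η ≥ max η₁`, and use `|𝔼 λ⋯λ| ≤ 1`
for smaller `η`. [cite: TaoTeravainen2021, §8 (first paragraph), §2.1 and Corollary 1.8 (ii)] -/
theorem TaoTeravainen2021_chowla_of_steps (h₁ : TaoTeravainen2021_prop42_k0)
    (h₃ : TaoTeravainen2021_prop63_k0) (h₅ : TaoTeravainen2021_prop81_k0) :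
    TaoTeravainen2021_chowla := by
  intro H hH hH1 ε₀ hε₀ _hε₀1
  obtain ⟨ψ, hψ⟩ := exists_isSmoothCutoff
  obtain ⟨ε₁, hε₁, H₁⟩ := h₁ H hH hH1
  obtain ⟨ε₃, hε₃, H₃⟩ := h₃ H hH hH1 ψ hψ
  obtain ⟨ε₅, hε₅, H₅⟩ := h₅ H hH hH1 ψ hψ
  set ε : ℝ := min ε₀ (min ε₁ (min ε₃ ε₅)) with hε
  have hε0 : 0 < ε := lt_min hε₀ (lt_min hε₁ (lt_min hε₃ hε₅))
  have hεε₀ : ε ≤ ε₀ := min_le_left _ _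
  have hεε₁ : ε ≤ ε₁ := (min_le_right _ _).trans (min_le_left _ _)
  have hεε₃ : ε ≤ ε₃ := (min_le_right _ _).trans ((min_le_right _ _).trans (min_le_left _ _))
  have hεε₅ : ε ≤ ε₅ := (min_le_right _ _).trans ((min_le_right _ _).trans (min_le_right _ _))
  obtain ⟨C₁, η₁, hC₁⟩ := H₁ ε hε0 hεε₁
  obtain ⟨C₃, η₃, hC₃⟩ := H₃ ε hε0 hεε₃
  obtain ⟨C₅, η₅, hC₅⟩ := H₅ ε hε0 hεε₅
  set η₀ : ℝ := max 10 (max η₁ (max η₃ η₅)) with hη₀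
  have hη₀10 : 10 ≤ η₀ := le_max_left _ _
  have hη₁₀ : η₁ ≤ η₀ := le_max_of_le_right (le_max_left _ _)
  have hη₃₀ : η₃ ≤ η₀ := le_max_of_le_right (le_max_of_le_right (le_max_left _ _))
  have hη₅₀ : η₅ ≤ η₀ := le_max_of_le_right (le_max_of_le_right (le_max_right _ _))
  refine ⟨max (C₁ + C₃ + C₅) (Real.log η₀ ^ ((1 : ℝ) / 10)), fun q _ χ η hS x hlo hhi => ?_⟩
  have hη10 : 10 ≤ η := hS.ten_le
  have hlogη : 0 < Real.log η := Real.log_pos (by linarith)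
  have hL : 0 < Real.log η ^ ((1 : ℝ) / 10) := Real.rpow_pos_of_pos hlogη _
  rcases le_or_gt η₀ η with hge | hlt
  · -- `η` large: concatenate the three steps at the shrunk `ε`
    have hq1 : (1 : ℝ) ≤ q := by exact_mod_cast NeZero.one_le
    have hlo' : (q : ℝ) ^ ((1 : ℝ) / 2 + ε) ≤ x :=
      (Real.rpow_le_rpow_of_exponent_le hq1 (by linarith)).trans hlo
    have e₁ := hC₁ q χ η hS (hη₁₀.trans hge) x hlo' hhi
    have e₃ := hC₃ q χ η hS (hη₃₀.trans hge) x hlo' hhi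
    have e₅ := hC₅ q χ η hS (hη₅₀.trans hge) x hlo' hhi
    set A := liouvilleTupleAverage H x
    set B := tupleAverage (liouvilleSiegel χ (scaleR η x)) H x
    set S := tupleAverage (liouvilleSiegelSharp χ ψ (scaleR η x) (scaleD #H ε x)) H x
    calc |A| = |(A - B) + (B - S) + S| := by rw [show (A - B) + (B - S) + S = A by ring]
      _ ≤ |A - B| + |B - S| + |S| := abs_add_three _ _ _
      _ ≤ C₁ / Real.log η ^ ((1 : ℝ) / 10) + C₃ / Real.log η ^ ((1 : ℝ) / 10) +
            C₅ / Real.log η ^ ((1 : ℝ) / 10) := add_le_add (add_le_add e₁ e₃) e₅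
      _ = (C₁ + C₃ + C₅) / Real.log η ^ ((1 : ℝ) / 10) := by ring
      _ ≤ _ := div_le_div_of_nonneg_right (le_max_left _ _) hL.le
  · -- `η = O(1)`: the trivial bound
    have h2 : Real.log η ^ ((1 : ℝ) / 10) ≤ Real.log η₀ ^ ((1 : ℝ) / 10) :=
      Real.rpow_le_rpow hlogη.le (Real.log_le_log (by linarith) hlt.le) (by norm_num)
    calc |liouvilleTupleAverage H x| ≤ 1 := abs_liouvilleTupleAverage_le_one H x
      _ ≤ max (C₁ + C₃ + C₅) (Real.log η₀ ^ ((1 : ℝ) / 10)) / Real.log η ^ ((1 : ℝ) / 10) := by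
          rw [le_div_iff₀ hL, one_mul]
          exact h2.trans (le_max_right _ _)

end Literature.Barriers.Parity
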